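import Literature.Computability.AlgebraicComplexity.BILPS19MinrankVarieties
import HarnessLib

/-!
# BILPS Lemma 18 discharged: the minrank varieties are `GL × GL × GL`-invariant

Proof file (theorem-only) for `BILPS2019_lemma18` of `BILPS19MinrankVarieties.lean`
(Bläser–Ikenmeyer–Lysikov–Pandey–Schreyer, arXiv:1911.02534, Lemma 18, p0023:L70: "If
`rk(Tx) ≤ r`, then `(F ⊗ G ⊗ H) T · (F x) = (G ⊗ H)(Tx)` also has rank at most `r` (here `F x`
denotes the dual action of `GL(U)` on `U*`)"). We prove the slice identity
`((A ⊗ B ⊗ C)T) y = B · (T (yA)) · Cᵀ` (`contract3_actTensor`) over any field and deduce the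
invariance over any field (`actTensor_mem_minrankSet`); the typed fact (algebraically closed `F`)
follows (`BILPS2019_lemma18_holds`). Honest framing (val-lit): a discharge of a typed literature
fact; nothing here bears on `VP ≠ VNP`.
-/

noncomputable section

namespace Literature.Computability.AlgebraicComplexity

open Matrix

section Slices

variable {F : Type*} [Field F] {ι κ μ : Type*} [Fintype ι] [Fintype κ] [Fintype μ]

omit [Fintype κ] [Fintype μ] in
/-- `Tx = ∑_a x_a A_a` as a sum of scaled slices. [cite: BlaserIkenmeyerLysikovPandeySchreyer2019, §5 (before Def. 13)] -/
theorem contract3_eq_sum_smul (T : ι → κ → μ → F) (x : ι → F) :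
    contract3 T x = ∑ a, x a • Matrix.of (T a) := by
  ext b c
  simp [contract3_apply, Matrix.sum_apply]

/-- The slices of `(A ⊗ B ⊗ C)·T`: slice `a` is `∑_{a'} A_{a a'} · (B · T_{a'} · Cᵀ)`.
[cite: BlaserIkenmeyerLysikovPandeySchreyer2019, Lemma 18 (proof)] -/
theorem actTensor_slice (A : Matrix ι ι F) (B : Matrix κ κ F) (C : Matrix μ μ F)
    (T : ι → κ → μ → F) (a : ι) :
    Matrix.of (actTensor A B C T a) = ∑ a', A a a' • (B * Matrix.of (T a') * Cᵀ) := by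
  ext b c
  simp only [Matrix.of_apply, actTensor_apply, Matrix.sum_apply, Matrix.smul_apply, smul_eq_mul,
    Matrix.mul_apply, Matrix.transpose_apply, Finset.mul_sum, Finset.sum_mul]
  refine Finset.sum_congr rfl fun a' _ => ?_
  rw [Finset.sum_comm]
  exact Finset.sum_congr rfl fun c' _ => Finset.sum_congr rfl fun b' _ => by ring

/-- **Slice identity** `((A ⊗ B ⊗ C)T) y = B · T(yA) · Cᵀ` ("`(F ⊗ G ⊗ H)T · (F^{-*} x) =
(G ⊗ H)(Tx)`", proof of Lemma 18). [cite: BlaserIkenmeyerLysikovPandeySchreyer2019, Lemma 18 (proof)] -/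
theorem contract3_actTensor (A : Matrix ι ι F) (B : Matrix κ κ F) (C : Matrix μ μ F)
    (T : ι → κ → μ → F) (y : ι → F) :
    contract3 (actTensor A B C T) y = B * contract3 T (Matrix.vecMul y A) * Cᵀ := by
  rw [contract3_eq_sum_smul, contract3_eq_sum_smul]
  simp_rw [actTensor_slice, Finset.smul_sum, smul_smul]
  rw [Finset.sum_comm, Matrix.mul_sum, Matrix.sum_mul]
  refine Finset.sum_congr rfl fun a' _ => ?_
  rw [← Finset.sum_smul, Matrix.mul_smul, Matrix.smul_mul]
  simp only [Matrix.vecMul, dotProduct]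

/-- **Invariance over any field**: if `T ∈ 𝓜_r` then `(A ⊗ B ⊗ C)T ∈ 𝓜_r` for invertible `A, B, C`
(with `y = x A^{-1}`, `rk(B (Tx) Cᵀ) ≤ rk(Tx)`). [cite: BlaserIkenmeyerLysikovPandeySchreyer2019, Lemma 18] -/
theorem actTensor_mem_minrankSet [DecidableEq ι] [DecidableEq κ] [DecidableEq μ] {r : ℕ}
    {T : ι → κ → μ → F} (hT : T ∈ (minrankSet F r : Set (ι → κ → μ → F)))
    (A : GL ι F) (B : GL κ F) (C : GL μ F) :
    actTensor (↑A : Matrix ι ι F) (↑B : Matrix κ κ F) (↑C : Matrix μ μ F) T ∈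
      (minrankSet F r : Set (ι → κ → μ → F)) := by
  obtain ⟨x, hx, hr⟩ := hT
  set y : ι → F := Matrix.vecMul x (↑A⁻¹ : Matrix ι ι F) with hy
  have hyA : Matrix.vecMul y (↑A : Matrix ι ι F) = x := by
    rw [hy, Matrix.vecMul_vecMul, Units.inv_mul, Matrix.vecMul_one]
  refine ⟨y, fun hy0 => hx ?_, ?_⟩
  · rw [← hyA, hy0, Matrix.zero_vecMul]
  · rw [contract3_actTensor, hyA]
    exact (Matrix.rank_mul_le_left _ _).trans ((Matrix.rank_mul_le_right _ _).trans hr)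

end Slices

/-- **BILPS Lemma 18, discharged.** [cite: BlaserIkenmeyerLysikovPandeySchreyer2019, Lemma 18] -/
theorem BILPS2019_lemma18_holds : BILPS2019_lemma18 :=
  fun _ _ _ _ _ _ _ _ A B C hT => actTensor_mem_minrankSet hT A B C

end Literature.Computability.AlgebraicComplexity
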